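import Mathlib
import Literature.Computability.Complexity.OracleSimulateFP
import Literature.Computability.Complexity.AdaptiveBPPSimulation
import Literature.Computability.Complexity.CodeFPArith
import Literature.Computability.Complexity.CountingHierarchyProofs
import Literature.Computability.Complexity.SumcheckMAReferee
import Summits.PneNP.PneNP.Theses.WitnessForging

/-!
# Route WitnessForging — support item `SatBridge` (stmt-PneNP-2432), part 1: oracle elimination

Helper file for the proof of `Summit.PneNP.PneNP.Theses.WitnessForging.SatBridge` (almost-uniform
generation of SAT witnesses from `NP ⊆ BPP`). This part is the oracle-free half of the bridge:
a polynomial-time oracle transducer `F ∈ FP^L` (transcript model, `Oracle.lean`) whose oracle is a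
`BPP` language `L` is reproduced, on all queries of length `≤ Qm` SIMULTANEOUSLY, by one
deterministic polynomial-time string function `Fst ⟨q, ⟨p, r⟩⟩` of the query `q`, a padding string
`p` and a coin string `r`, for all but a fraction `≤ 2^{-(|p|+1)}` of the coin strings `r`
(Arora–Barak 2009, §7.4.1 with Thm. 7.10: reduce the error of the `BPP` algorithm for `L` to
`2^{-|⟨s,p⟩|}` on the padded query `⟨s, p⟩`, answer every oracle query `s` with the SAME coins `r`,
and take the union bound over all strings of length `≤` the query bound; "`BPP^{BPP} = BPP`",
Ko 1982, Zachos 1988). The machine side is the emulation `OracleAlg.simFn` of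
`OracleSimulateFP.lean` (`FP^{ans} ⊆ FP` for the coin-reading answer rule `ans ∈ FP`).

* `SatBridgeJVV.runAux_congr_of_agree` — runs against oracles agreeing on the queries coincide;
* `SatBridgeJVV.queriesAux_eq_of_runAux` — no query is asked after the output;
* `SatBridgeJVV.exists_ans` — the answer rule simulating the oracle from the coins;
* `SatBridgeJVV.uniformProb_not_good_le` — the union bound;
* **`SatBridgeJVV.oracle_elimination`** — the packaged statement consumed by the sampler.
-/



set_option linter.dupNamespace false -- `Summit.PneNP.PneNP.…`: summit = sub-problem (D-0017)

namespace Summit.PneNP.PneNP.Theorems.SatBridgeJVV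

open Literature.Computability.Complexity
open _root_.Computability Polynomial Brick CodeFP

variable {β : Type}

/-! ### Runs against agreeing oracles (transcript model of `Oracle.lean`) -/

/-- **Runs against two oracles that agree on every query asked coincide** (auxiliary form, from a
partial transcript): same output and same queries. [folklore] -/
theorem runAux_congr_of_agree (M : OracleAlg β) (O O' : Oracle) (x : List Bool) :
    ∀ (k : ℕ) (as : List (List Bool)), (∀ q ∈ M.queriesAux O x k as, O' q = O q) →
      M.runAux O' x k as = M.runAux O x k as ∧ M.queriesAux O' x k as = M.queriesAux O x k as
  | 0, _, _ => ⟨rfl, rfl⟩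
  | k + 1, as, h => by
    rw [OracleAlg.runAux_succ, OracleAlg.runAux_succ]
    unfold OracleAlg.queriesAux at h ⊢
    cases hs : M.step x as with
    | inl q =>
      rw [hs] at h
      simp only [List.mem_cons, forall_eq_or_imp] at h
      obtain ⟨hq, hrest⟩ := h
      have ih := runAux_congr_of_agree M O O' x k (as ++ [O q]) hrest
      simp only [hq]
      exact ⟨ih.1, by rw [ih.2]⟩
    | inr b => exact ⟨rfl, rfl⟩

/-- **Runs against two oracles that agree on every query asked coincide.** [folklore] -/
theorem run_congr_of_agree (M : OracleAlg β) {O O' : Oracle} {k : ℕ} {x : List Bool}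
    (h : ∀ q ∈ M.queries O k x, O' q = O q) :
    M.run O' k x = M.run O k x ∧ M.queries O' k x = M.queries O k x :=
  runAux_congr_of_agree M O O' x k [] h

/-- **No query is asked after the output**: if the run outputs within `k` rounds, the transcript
within `k + d` rounds is the transcript within `k` rounds. [folklore] -/
theorem queriesAux_eq_of_runAux (M : OracleAlg β) (O : Oracle) (x : List Bool) :
    ∀ (k d : ℕ) (as : List (List Bool)) {b : β}, M.runAux O x k as = some b →
      M.queriesAux O x (k + d) as = M.queriesAux O x k as
  | 0, _, _, _, h => by simp at h
  | k + 1, d, as, b, h => by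
    rw [OracleAlg.runAux_succ] at h
    rw [show k + 1 + d = (k + d) + 1 by omega]
    unfold OracleAlg.queriesAux
    cases hs : M.step x as with
    | inl q =>
      rw [hs] at h
      show q :: M.queriesAux O x (k + d) (as ++ [O q]) = q :: M.queriesAux O x k (as ++ [O q])
      rw [queriesAux_eq_of_runAux M O x k d (as ++ [O q]) h]
    | inr b' => rfl

/-- The transcript is stable once the output is produced: for `k ≤ k'` and a run that outputs
within `k` rounds, `M.queries O k' x = M.queries O k x`. [folklore] -/
theorem queries_eq_of_run (M : OracleAlg β) {O : Oracle} {k k' : ℕ} {x : List Bool} {b : β}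
    (hk : k ≤ k') (h : M.run O k x = some b) : M.queries O k' x = M.queries O k x := by
  obtain ⟨d, rfl⟩ := Nat.exists_eq_add_of_le hk
  exact queriesAux_eq_of_runAux M O x k d [] h


/-! ### The oracle simulated from a coin string -/

/-- **The answering brick** of the emulation: on the tagged query `⟨⟨q, ⟨p, r⟩⟩, s⟩` answer the bit
`[s ∈ simLang B t p r]`, in polynomial time for `B ∈ P`. [folklore] -/
theorem exists_ans {B : Language Bool} (hB : B ∈ Classes.P) (t : Polynomial ℕ) :
    ∃ ans : List Bool → List Bool, ans ∈ FP ∧ ∀ q p r s : List Bool,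
      ans (boolPair (boolPair q (boolPair p r)) s) =
        encodeBool (B.boolIndicator (boolPair (boolPair s p) (r.take (t.eval (boolPair s p).length)))) := by
  -- typed argument `((q, (p, r)), s)`
  have hs : CodeFP (pairE (pairE strE (pairE strE strE)) strE) strE
      (fun a : (List Bool × (List Bool × List Bool)) × List Bool => a.2) := CodeFP.snd _ _
  have hp : CodeFP (pairE (pairE strE (pairE strE strE)) strE) strE
      (fun a : (List Bool × (List Bool × List Bool)) × List Bool => a.1.2.1) :=
    (CodeFP.fst _ _).snd'.fst'
  have hr : CodeFP (pairE (pairE strE (pairE strE strE)) strE) strE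
      (fun a : (List Bool × (List Bool × List Bool)) × List Bool => a.1.2.2) :=
    (CodeFP.fst _ _).snd'.snd'
  have hsp : CodeFP (pairE (pairE strE (pairE strE strE)) strE) strE
      (fun a : (List Bool × (List Bool × List Bool)) × List Bool => boolPair a.2 a.1.2.1) :=
    (hs.pair hp).recodeOut fun _ => rfl
  have hlen : CodeFP (pairE (pairE strE (pairE strE strE)) strE) unE
      (fun a : (List Bool × (List Bool × List Bool)) × List Bool =>
        t.eval (boolPair a.2 a.1.2.1).length) :=
    (SumcheckMA.polyU t).comp hsp
  have htake : CodeFP (pairE (pairE strE (pairE strE strE)) strE) strE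
      (fun a : (List Bool × (List Bool × List Bool)) × List Bool =>
        a.1.2.2.take (t.eval (boolPair a.2 a.1.2.1).length)) :=
    strTake.comp (hlen.pair hr)
  have hq : CodeFP (pairE (pairE strE (pairE strE strE)) strE) strE
      (fun a : (List Bool × (List Bool × List Bool)) × List Bool =>
        boolPair (boolPair a.2 a.1.2.1) (a.1.2.2.take (t.eval (boolPair a.2 a.1.2.1).length))) :=
    (hsp.pair htake).recodeOut fun _ => rfl
  have hind : CodeFP strE bitE (fun w : List Bool => B.boolIndicator w) :=
    CodeFP.of_fn _ (indicatorFn_mem_FP hB) fun _ => rfl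
  obtain ⟨ans, hans, heq⟩ := hind.comp hq
  refine ⟨ans, hans, fun q p r s => ?_⟩
  have h := heq ((q, (p, r)), s)
  simp only [pairE_apply] at h
  exact h

/-! ### Good coin strings -/

/-- **The union bound.** If `B`, `t` decide the padded language `fstF ⁻¹' L` with error
`≤ 2^{-|z|}` on every `z`, then for `T ≥ t(2C + 2 + |p|)` the coin strings of length `T` that are
NOT good have probability `≤ 2^{-(|p|+1)}`: a bad string errs on some `s` with `|s| ≤ C`, an event
of probability `≤ 2^{-(2|s| + 2 + |p|)}` (prefix coins), and `Σ_{j ≤ C} 2^j 2^{-(2j+2+|p|)} ≤ 2^{-(|p|+1)}`.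
[cite: AroraBarak2009, §7.4.1 (error reduction and the union bound)] -/
theorem uniformProb_not_good_le {L B : Language Bool} {t : Polynomial ℕ}
    (hB : ∀ z : List Bool,
      uniformProb (t.eval z.length) {y | ¬ (boolPair z y ∈ B ↔ fstF z ∈ L)} ≤ 1 / 2 ^ z.length)
    (C : ℕ) (p : List Bool) {T : ℕ} (hT : t.eval (2 * C + 2 + p.length) ≤ T) :
    uniformProb T {r | ¬ ∀ s : List Bool, s.length ≤ C →
      (boolPair (boolPair s p) (r.take (t.eval (boolPair s p).length)) ∈ B ↔ s ∈ L)} ≤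
      1 / 2 ^ (p.length + 1) := by
  classical
  set Bad : List Bool → Set (List Bool) := fun s =>
    {r | ¬ (boolPair (boolPair s p) (r.take (t.eval (boolPair s p).length)) ∈ B ↔ s ∈ L)} with hBad
  have hBadP : ∀ s : List Bool, s.length ≤ C →
      uniformProb T (Bad s) ≤ (1 / 2 : ℝ) ^ (2 * s.length + 2 + p.length) := by
    intro s hs
    set z := boolPair s p with hz
    have hzlen : z.length = 2 * s.length + 2 + p.length := by rw [hz, length_boolPair]
    have hts : t.eval z.length ≤ T := (TM2Iter.eval_mono t (by rw [hzlen]; omega)).trans hT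
    have hE : uniformProb (t.eval z.length) {y | ¬ (boolPair z y ∈ B ↔ s ∈ L)} ≤
        (1 / 2 : ℝ) ^ z.length := by
      have h := hB z
      rw [show fstF z = s by rw [hz, fstF_boolPair], one_div, ← inv_pow] at h
      simpa [one_div] using h
    have hset : Bad s = {r | r.take (t.eval z.length) ∈ {y | ¬ (boolPair z y ∈ B ↔ s ∈ L)}} := by
      ext r
      simp only [hBad, Set.mem_setOf_eq, ← hz]
    rw [hset, uniformProb_take_of_le hts, ← hzlen]
    exact hE
  have hsub : ∀ r ∈ {r : List Bool | ¬ ∀ s : List Bool, s.length ≤ C →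
      (boolPair (boolPair s p) (r.take (t.eval (boolPair s p).length)) ∈ B ↔ s ∈ L)}, r.length = T →
      r ∈ ⋃ j ∈ Finset.range (C + 1), ⋃ v ∈ (Finset.univ : Finset (List.Vector Bool j)), Bad v.toList := by
    intro r hr _
    by_contra hgood
    simp only [Set.mem_iUnion, Finset.mem_range, Finset.mem_univ, exists_true_left, not_exists] at hgood
    apply hr
    intro s hs
    have h := hgood s.length (by omega) ⟨s, rfl⟩
    simpa [hBad] using h
  calc uniformProb T {r : List Bool | ¬ ∀ s : List Bool, s.length ≤ C →
      (boolPair (boolPair s p) (r.take (t.eval (boolPair s p).length)) ∈ B ↔ s ∈ L)}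
      ≤ uniformProb T (⋃ j ∈ Finset.range (C + 1),
          ⋃ v ∈ (Finset.univ : Finset (List.Vector Bool j)), Bad v.toList) :=
        BPExp.uniformProb_mono_len hsub
    _ ≤ ∑ j ∈ Finset.range (C + 1),
          uniformProb T (⋃ v ∈ (Finset.univ : Finset (List.Vector Bool j)), Bad v.toList) :=
        uniformProb_biUnion_le _ _ _
    _ ≤ ∑ j ∈ Finset.range (C + 1),
          ∑ v ∈ (Finset.univ : Finset (List.Vector Bool j)), uniformProb T (Bad v.toList) :=
        Finset.sum_le_sum fun j _ => uniformProb_biUnion_le _ _ _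
    _ ≤ ∑ j ∈ Finset.range (C + 1), ∑ v ∈ (Finset.univ : Finset (List.Vector Bool j)),
          (1 / 2 : ℝ) ^ (2 * j + 2 + p.length) :=
        Finset.sum_le_sum fun j hj => Finset.sum_le_sum fun v _ => by
          have := hBadP v.toList (by
            rw [List.Vector.toList_length]; exact Nat.lt_succ_iff.1 (Finset.mem_range.1 hj))
          rwa [List.Vector.toList_length] at this
    _ = ∑ j ∈ Finset.range (C + 1), (1 / 2 : ℝ) ^ (p.length + 2) * (1 / 2) ^ j := by
        refine Finset.sum_congr rfl fun j _ => ?_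
        rw [Finset.sum_const, Finset.card_univ, card_vector, Fintype.card_bool, nsmul_eq_mul]
        push_cast
        rw [show 2 * j + 2 + p.length = j + (j + (p.length + 2)) by ring, pow_add, pow_add,
          ← mul_assoc, ← mul_assoc, ← mul_pow]
        norm_num
        rw [mul_comm]
    _ = (1 / 2 : ℝ) ^ (p.length + 2) * ∑ j ∈ Finset.range (C + 1), (1 / 2 : ℝ) ^ j := by
        rw [Finset.mul_sum]
    _ ≤ (1 / 2 : ℝ) ^ (p.length + 2) * 2 := by
        gcongr
        exact AdBPPSim.sum_half_pow_le_two _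
    _ = 1 / 2 ^ (p.length + 1) := by
        rw [pow_succ, one_div, inv_pow]
        field_simp

/-! ### The packaged statement -/

/-- **Oracle elimination for `FP^L`, `L ∈ BPP`.** For `L ∈ BPP` and `F ∈ FP^L` there are a
polynomial-time string function `Fst` and a polynomial `τ` such that for every query bound `Qm`,
every padding string `p` and every coin length `T ≥ τ(Qm + |p|)`, for all but a fraction
`≤ 2^{-(|p|+1)}` of the coin strings `r ∈ {0,1}^T` one has `Fst ⟨q, ⟨p, r⟩⟩ = F q` for EVERY `q`
with `|q| ≤ Qm`. (Error reduction of the `BPP` algorithm to `2^{-|⟨s,p⟩|}` on padded queries, one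
coin string for all queries, union bound; the emulation is `OracleAlg.simFn`.)
[cite: AroraBarak2009, §7.4.1 with Thm. 7.10] -/
theorem oracle_elimination {L : Language Bool} (hL : L ∈ BPP) {F : List Bool → List Bool}
    (hF : F ∈ FPRel (Oracle.ofLanguage L)) :
    ∃ Fst : List Bool → List Bool, Fst ∈ FP ∧ ∃ τ : Polynomial ℕ,
      ∀ (Qm : ℕ) (p : List Bool) (T : ℕ), τ.eval (Qm + p.length) ≤ T →
        uniformProb T {r | ∃ q : List Bool, q.length ≤ Qm ∧
          Fst (boolPair q (boolPair p r)) ≠ F q} ≤ 1 / 2 ^ (p.length + 1) := by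
  classical
  -- error reduction for the padded language
  have hL' : (fstF ⁻¹' L : Language Bool) ∈ BPP := preimage_mem_BPP hL fstF_mem_FP
  obtain ⟨B, hB, t, ht⟩ := BPP_subset_bpErr_two_pow 1 hL'
  have hBt : ∀ z : List Bool,
      uniformProb (t.eval z.length) {y | ¬ (boolPair z y ∈ B ↔ fstF z ∈ L)} ≤ 1 / 2 ^ z.length := by
    intro z
    have h := ht z
    simp only [pow_one] at h
    exact h
  -- the machine of `F`
  obtain ⟨M, hM, qF, hrun⟩ := hF
  obtain ⟨ans, hans, hanseq⟩ := exists_ans hB t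
  refine ⟨OracleAlg.simFn M fstF ans qF qF, OracleAlg.simFn_mem_FP hM fstF_mem_FP hans qF qF,
    t.comp (2 * qF + X + 2), fun Qm p T hT => ?_⟩
  have hT' : t.eval (2 * qF.eval Qm + 2 + p.length) ≤ T := by
    have h1 : 2 * qF.eval Qm + 2 + p.length ≤ (2 * qF + X + 2 : Polynomial ℕ).eval (Qm + p.length) := by
      have := TM2Iter.eval_mono qF (Nat.le_add_right Qm p.length)
      simp only [eval_add, eval_mul, eval_ofNat, eval_X]
      omega
    have h2 : (t.comp (2 * qF + X + 2)).eval (Qm + p.length) =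
        t.eval ((2 * qF + X + 2 : Polynomial ℕ).eval (Qm + p.length)) := by
      rw [eval_comp]
    rw [h2] at hT
    exact (TM2Iter.eval_mono t h1).trans hT
  refine le_trans (BPExp.uniformProb_mono_len fun r hr _ => ?_)
    (uniformProb_not_good_le hBt (qF.eval Qm) p hT')
  -- a coin string on which some short query is answered wrongly is not good
  simp only [Set.mem_setOf_eq] at hr
  obtain ⟨q, hq, hne⟩ := hr
  simp only [Set.mem_setOf_eq]
  intro hgood
  apply hne
  set w := boolPair q (boolPair p r) with hw
  -- the simulated oracle
  set O' : Oracle := fun s => ans (boolPair w s) with hO'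
  obtain ⟨hrunq, hqq⟩ := hrun q
  -- agreement on the queries of the true run
  have hagree : ∀ s ∈ M.queries (Oracle.ofLanguage L) (qF.eval q.length) q,
      O' s = Oracle.ofLanguage L s := by
    intro s hs
    have hsl : s.length ≤ qF.eval Qm := (hqq s hs).trans (TM2Iter.eval_mono qF hq)
    rw [hO', Oracle.ofLanguage_apply]
    dsimp only
    rw [hw, hanseq, AdBPPSim.boolIndicator_congr' (hgood s hsl)]
  obtain ⟨hrun', hqs'⟩ := run_congr_of_agree M hagree
  have hqw : q.length ≤ w.length := by rw [hw, length_boolPair]; omega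
  have hKK : qF.eval q.length ≤ qF.eval w.length := TM2Iter.eval_mono qF hqw
  have hpre : fstF w = q := by rw [hw, fstF_boolPair]
  refine OracleAlg.simFn_eq_of_run ?_ ?_
  · rw [← hO', hpre]
    exact M.run_mono _ _ hKK (hrun'.trans hrunq)
  · intro s hs
    rw [← hO', hpre, queries_eq_of_run M hKK (hrun'.trans hrunq), hqs'] at hs
    exact (hqq s hs).trans hKK

end Summit.PneNP.PneNP.Theorems.SatBridgeJVV
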